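import Mathlib

/-!
# Route `FilamentSkeletonRss` · crux `TransverseReductionRJ` (stmt-NavierStokesRegularity-21221) — line `kelvin_gate`,
# stub S2′ `EventualKelvinGate`: the EXACT INVERSE of the self-similar TRANSPORT operator `½ + ½ y·∇` in the line's decay classes

Helper file (theorems only, `--supports stmt-NavierStokesRegularity-21221 --as helper`), Mathlib-only (no route vocabulary),
written for arbitrary real normed spaces.  HONEST FRAMING: analysis bookkeeping for a HYPOTHETICAL filament-type RSS
blow-up route; nothing here bears on Navier–Stokes regularity; no stub is proved here.

The linearised profile operator of the line is `𝓛 = (½ + ½ y·∇) − Δ + α𝓡₀ + (base terms)`; its gate (stub S2′) maps the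
Y-scale (`⟨y⟩²`-decay) to the X-scale (`⟨y⟩`-decay).  The loss of exactly one power of `⟨y⟩` is produced by the transport
part alone, whose inverse is explicit:
`(T F)(y) := ∫₀^∞ e^{-t/2} F(e^{-t/2} y) dt`  solves  `½ (T F)(y) + ½ D(T F)(y)[y] = F(y)`.
This file proves, for `F ∈ C¹` with `(1 + ‖y‖)² ‖F y‖ ≤ R` and `(1 + ‖y‖)² ‖DF y‖ ≤ R`:

* `transport_kernel_integral` — the scalar kernel: `∫₀^∞ e^{t/2} (e^{t/2} + a)^{-2} dt = 2/(1+a)` (`a ≥ 0`), with integrability;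
* `transport_integrable`, `transport_norm_le` — the integral defining `T F (y)` converges and `(1 + ‖y‖) ‖T F (y)‖ ≤ 2R`;
* `transport_hasFDerivAt`, `transport_fderiv_norm_le` — `T F` is differentiable with
  `D(T F)(y) = ∫₀^∞ e^{-t} DF(e^{-t/2} y) dt` and `(1 + ‖y‖) ‖D(T F)(y)‖ ≤ 2R`;
* `transport_equation` — `½ T F (y) + ½ D(T F)(y)[y] = F y` (FTC on `(0, ∞)` for `t ↦ e^{-t/2} F(e^{-t/2} y)`);
* `transport_resolvent` — the packaged existence statement (explicit formula, differentiability, both weighted bounds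
  with constant `2`, the equation).
What this is NOT: the gate needs `C²` output and the Laplacian; `T` does not smooth (`T F` is `C¹` for `F ∈ C¹`).  It is
the far-field/transport backbone of the free gate `(𝓛 at U⁰ = 0)⁻¹` recorded as missing in the item's census.
-/

set_option linter.dupNamespace false

noncomputable section

namespace Summit.NavierStokesRegularity.NavierStokesRegularity.Theorems.KelvinGate

open Set Filter MeasureTheory Real
open scoped Topology

section Transport

variable {E V : Type*} [NormedAddCommGroup E] [NormedSpace ℝ E] [NormedAddCommGroup V] [NormedSpace ℝ V]
  [CompleteSpace V]

/-! ## The scalar kernel `e^{t/2} / (e^{t/2} + a)²` -/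

/-- **The transport kernel integrates to `2/(1+a)`.**  For `a ≥ 0`,
`t ↦ e^{t/2} / (e^{t/2} + a)²` is integrable on `(0, ∞)` with integral `2 / (1 + a)`
(antiderivative `−2 / (e^{t/2} + a)`, which tends to `0`). -/
theorem transport_kernel_integral {a : ℝ} (ha : 0 ≤ a) :
    IntegrableOn (fun t : ℝ => exp (t / 2) / (exp (t / 2) + a) ^ 2) (Ioi 0) ∧
    ∫ t in Ioi (0:ℝ), exp (t / 2) / (exp (t / 2) + a) ^ 2 = 2 / (1 + a) := by
  have hpos : ∀ t : ℝ, 0 < exp (t / 2) + a := fun t => by positivity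
  -- the antiderivative and its derivative
  have hderiv : ∀ t : ℝ, HasDerivAt (fun s : ℝ => -2 * (exp (s / 2) + a)⁻¹)
      (exp (t / 2) / (exp (t / 2) + a) ^ 2) t := by
    intro t
    have h1 : HasDerivAt (fun s : ℝ => exp (s / 2) + a) (exp (t / 2) * (1 / 2)) t := by
      have := ((hasDerivAt_id t).div_const 2).exp
      simpa using this.add_const a
    have h2 := (h1.inv (hpos t).ne').const_mul (-2)
    refine h2.congr_deriv ?_
    rw [div_eq_mul_inv, div_eq_mul_inv]
    ring
  have hlim : Tendsto (fun s : ℝ => -2 * (exp (s / 2) + a)⁻¹) atTop (𝓝 0) := by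
    have h1 : Tendsto (fun s : ℝ => exp (s / 2) + a) atTop atTop :=
      tendsto_atTop_add_const_right _ _ (tendsto_exp_atTop.comp (tendsto_id.atTop_div_const (by norm_num)))
    have h2 := h1.inv_tendsto_atTop.const_mul (-2)
    rwa [mul_zero] at h2
  have hcont : ContinuousWithinAt (fun s : ℝ => -2 * (exp (s / 2) + a)⁻¹) (Ici 0) 0 := by
    refine Continuous.continuousWithinAt ?_
    exact continuous_const.mul
      ((((continuous_exp.comp (continuous_id.div_const (2:ℝ))).add continuous_const).inv₀ fun s => (hpos s).ne'))
  have hint : IntegrableOn (fun t : ℝ => exp (t / 2) / (exp (t / 2) + a) ^ 2) (Ioi 0) :=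
    integrableOn_Ioi_deriv_of_nonneg hcont (fun t _ => hderiv t) (fun t _ => by positivity) hlim
  refine ⟨hint, ?_⟩
  rw [integral_Ioi_of_hasDerivAt_of_tendsto hcont (fun t _ => hderiv t) hint hlim]
  show (0:ℝ) - (-2 * (exp ((0:ℝ) / 2) + a)⁻¹) = 2 / (1 + a)
  rw [zero_div, Real.exp_zero, div_eq_mul_inv]
  ring

/-- The pointwise identity behind the Y → X bookkeeping:
`e^{-t/2} · R / (1 + e^{-t/2} a)² = R · e^{t/2} / (e^{t/2} + a)²`. -/
theorem transport_weight_identity (R a t : ℝ) :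
    exp (-(t / 2)) * (R / (1 + exp (-(t / 2)) * a) ^ 2) = R * (exp (t / 2) / (exp (t / 2) + a) ^ 2) := by
  have h : exp (-(t / 2)) = (exp (t / 2))⁻¹ := exp_neg _
  have hne : exp (t / 2) ≠ 0 := (exp_pos _).ne'
  rw [h]
  field_simp

omit [NormedSpace ℝ E] [NormedSpace ℝ V] [CompleteSpace V] in
/-- From the Y-type bound `(1 + ‖z‖)² ‖F z‖ ≤ R`: `‖F z‖ ≤ R / (1 + ‖z‖)²`. -/
theorem norm_le_of_weight_sq_le {F : E → V} {R : ℝ} (hb : ∀ z, (1 + ‖z‖) ^ 2 * ‖F z‖ ≤ R) (z : E) :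
    ‖F z‖ ≤ R / (1 + ‖z‖) ^ 2 := by
  rw [le_div_iff₀ (by positivity), mul_comm]
  exact hb z

/-! ## The integral `T F (y) = ∫₀^∞ e^{-t/2} F(e^{-t/2} y) dt` -/

omit [CompleteSpace V] in
/-- **Domination of the transport integrand** by `R` times the kernel. -/
theorem transport_integrand_norm_le {F : E → V} {R : ℝ} (hb : ∀ z, (1 + ‖z‖) ^ 2 * ‖F z‖ ≤ R)
    (y : E) (t : ℝ) :
    ‖exp (-(t / 2)) • F (exp (-(t / 2)) • y)‖ ≤ R * (exp (t / 2) / (exp (t / 2) + ‖y‖) ^ 2) := by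
  rw [norm_smul, Real.norm_eq_abs, abs_of_pos (exp_pos _), ← transport_weight_identity R ‖y‖ t]
  refine mul_le_mul_of_nonneg_left ?_ (exp_pos _).le
  have h := norm_le_of_weight_sq_le hb (exp (-(t / 2)) • y)
  rwa [norm_smul, Real.norm_eq_abs, abs_of_pos (exp_pos _)] at h

omit [CompleteSpace V] in
/-- **Convergence**: the transport integrand is integrable on `(0, ∞)` for continuous `F` with `(1+‖z‖)² ‖F z‖ ≤ R`. -/
theorem transport_integrable {F : E → V} {R : ℝ} (hF : Continuous F) (hb : ∀ z, (1 + ‖z‖) ^ 2 * ‖F z‖ ≤ R)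
    (y : E) : IntegrableOn (fun t : ℝ => exp (-(t / 2)) • F (exp (-(t / 2)) • y)) (Ioi 0) := by
  have hcont : Continuous fun t : ℝ => exp (-(t / 2)) • F (exp (-(t / 2)) • y) :=
    (continuous_exp.comp (continuous_id.div_const _).neg).smul
      (hF.comp ((continuous_exp.comp (continuous_id.div_const _).neg).smul continuous_const))
  refine Integrable.mono' (((transport_kernel_integral (norm_nonneg y)).1).const_mul R)
    hcont.aestronglyMeasurable ?_
  exact Eventually.of_forall fun t => transport_integrand_norm_le hb y t

omit [CompleteSpace V] in
/-- **The Y → X decay of the transport inverse**: `(1 + ‖y‖) · ‖∫₀^∞ e^{-t/2} F(e^{-t/2} y) dt‖ ≤ 2R`. -/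
theorem transport_norm_le {F : E → V} {R : ℝ} (hb : ∀ z, (1 + ‖z‖) ^ 2 * ‖F z‖ ≤ R)
    (y : E) : (1 + ‖y‖) * ‖∫ t in Ioi (0:ℝ), exp (-(t / 2)) • F (exp (-(t / 2)) • y)‖ ≤ 2 * R := by
  have hker := transport_kernel_integral (norm_nonneg y)
  have h1 : ‖∫ t in Ioi (0:ℝ), exp (-(t / 2)) • F (exp (-(t / 2)) • y)‖ ≤
      ∫ t in Ioi (0:ℝ), R * (exp (t / 2) / (exp (t / 2) + ‖y‖) ^ 2) := by
    refine norm_integral_le_of_norm_le (hker.1.const_mul R) ?_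
    exact Eventually.of_forall fun t => transport_integrand_norm_le hb y t
  rw [integral_const_mul, hker.2] at h1
  have hy : 0 < 1 + ‖y‖ := by positivity
  calc (1 + ‖y‖) * ‖∫ t in Ioi (0:ℝ), exp (-(t / 2)) • F (exp (-(t / 2)) • y)‖
      ≤ (1 + ‖y‖) * (R * (2 / (1 + ‖y‖))) := mul_le_mul_of_nonneg_left h1 hy.le
    _ = 2 * R := by field_simp

/-! ## Differentiation under the integral -/

omit [CompleteSpace V] in
/-- **Domination of the differentiated integrand**: with `(1+‖z‖)² ‖DF z‖ ≤ R`,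
`‖e^{-t} • DF(e^{-t/2} y)‖ ≤ R · e^{t/2}/(e^{t/2}+‖y‖)²` for `t ≥ 0` (one uses `e^{-t} ≤ e^{-t/2}`). -/
theorem transport_fderiv_integrand_norm_le {F : E → V} {R : ℝ} (hb' : ∀ z, (1 + ‖z‖) ^ 2 * ‖fderiv ℝ F z‖ ≤ R)
    (y : E) {t : ℝ} (ht : 0 ≤ t) :
    ‖(exp (-(t / 2)) * exp (-(t / 2))) • fderiv ℝ F (exp (-(t / 2)) • y)‖ ≤
      R * (exp (t / 2) / (exp (t / 2) + ‖y‖) ^ 2) := by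
  have hR : 0 ≤ R := le_trans (by positivity) (hb' 0)
  have hle : exp (-(t / 2)) * exp (-(t / 2)) ≤ exp (-(t / 2)) := by
    have h1 : exp (-(t / 2)) ≤ 1 := exp_le_one_iff.mpr (by linarith)
    nlinarith [exp_pos (-(t / 2))]
  have hD := norm_le_of_weight_sq_le hb' (exp (-(t / 2)) • y)
  rw [norm_smul, Real.norm_eq_abs, abs_of_pos (exp_pos _)] at hD
  calc ‖(exp (-(t / 2)) * exp (-(t / 2))) • fderiv ℝ F (exp (-(t / 2)) • y)‖
      = exp (-(t / 2)) * exp (-(t / 2)) * ‖fderiv ℝ F (exp (-(t / 2)) • y)‖ := by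
        rw [norm_smul, Real.norm_eq_abs, abs_of_pos (by positivity)]
    _ ≤ exp (-(t / 2)) * (R / (1 + exp (-(t / 2)) * ‖y‖) ^ 2) :=
        mul_le_mul hle hD (norm_nonneg _) (exp_pos _).le
    _ = R * (exp (t / 2) / (exp (t / 2) + ‖y‖) ^ 2) := transport_weight_identity R ‖y‖ t

omit [CompleteSpace V] in
/-- **`T F` is differentiable, with the derivative obtained under the integral sign**:
`D(T F)(y) = ∫₀^∞ e^{-t} DF(e^{-t/2} y) dt`. -/
theorem transport_hasFDerivAt {F : E → V} {R : ℝ} (hF : ContDiff ℝ 1 F)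
    (hb : ∀ z, (1 + ‖z‖) ^ 2 * ‖F z‖ ≤ R) (hb' : ∀ z, (1 + ‖z‖) ^ 2 * ‖fderiv ℝ F z‖ ≤ R) (y : E) :
    HasFDerivAt (fun x : E => ∫ t in Ioi (0:ℝ), exp (-(t / 2)) • F (exp (-(t / 2)) • x))
      (∫ t in Ioi (0:ℝ), (exp (-(t / 2)) * exp (-(t / 2))) • fderiv ℝ F (exp (-(t / 2)) • y)) y := by
  have hR : 0 ≤ R := le_trans (by positivity) (hb' 0)
  have hFc : Continuous F := hF.continuous
  have hDc : Continuous (fderiv ℝ F) := hF.continuous_fderiv one_ne_zero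
  have hdiff : ∀ z, HasFDerivAt F (fderiv ℝ F z) z := fun z =>
    (hF.differentiable (by norm_num) z).hasFDerivAt
  -- pointwise derivative in `x` of the integrand
  have hpt : ∀ (t : ℝ) (x : E), HasFDerivAt (fun x : E => exp (-(t / 2)) • F (exp (-(t / 2)) • x))
      ((exp (-(t / 2)) * exp (-(t / 2))) • fderiv ℝ F (exp (-(t / 2)) • x)) x := by
    intro t x
    have h1 : HasFDerivAt (fun x : E => F (exp (-(t / 2)) • x))
        ((fderiv ℝ F (exp (-(t / 2)) • x)).comp (exp (-(t / 2)) • ContinuousLinearMap.id ℝ E)) x :=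
      (hdiff _).comp x ((exp (-(t / 2)) • ContinuousLinearMap.id ℝ E).hasFDerivAt)
    have h2 : HasFDerivAt (fun x : E => exp (-(t / 2)) • F (exp (-(t / 2)) • x))
        (exp (-(t / 2)) • ((fderiv ℝ F (exp (-(t / 2)) • x)).comp (exp (-(t / 2)) • ContinuousLinearMap.id ℝ E))) x :=
      h1.fun_const_smul _
    refine h2.congr_fderiv ?_
    ext v
    show exp (-(t / 2)) • fderiv ℝ F (exp (-(t / 2)) • x) (exp (-(t / 2)) • v) =
      (exp (-(t / 2)) * exp (-(t / 2))) • fderiv ℝ F (exp (-(t / 2)) • x) v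
    rw [map_smul, smul_smul]
  -- domination on the ball of radius 1 (in fact everywhere): `‖F' x t‖ ≤ R · kernel(t, 0) ≤ R e^{-t/2}`… we use the
  -- `x`-independent bound `R * exp (-(t/2))`
  have hbound : ∀ (t : ℝ), 0 < t → ∀ x : E,
      ‖(exp (-(t / 2)) * exp (-(t / 2))) • fderiv ℝ F (exp (-(t / 2)) • x)‖ ≤ R * exp (-(t / 2)) := by
    intro t ht x
    have h := transport_fderiv_integrand_norm_le hb' x ht.le
    refine h.trans (mul_le_mul_of_nonneg_left ?_ hR)
    -- `e^{t/2}/(e^{t/2}+‖x‖)² ≤ e^{t/2}/(e^{t/2})² = e^{-t/2}`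
    have hp : 0 < exp (t / 2) := exp_pos _
    have hle : exp (t / 2) ^ 2 ≤ (exp (t / 2) + ‖x‖) ^ 2 := by
      nlinarith [norm_nonneg x]
    calc exp (t / 2) / (exp (t / 2) + ‖x‖) ^ 2 ≤ exp (t / 2) / exp (t / 2) ^ 2 :=
          div_le_div_of_nonneg_left hp.le (by positivity) hle
      _ = exp (-(t / 2)) := by rw [exp_neg]; field_simp
  refine hasFDerivAt_integral_of_dominated_of_fderiv_le (𝕜 := ℝ) (μ := volume.restrict (Ioi (0:ℝ)))
    (F := fun (x : E) (t : ℝ) => exp (-(t / 2)) • F (exp (-(t / 2)) • x))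
    (F' := fun (x : E) (t : ℝ) => (exp (-(t / 2)) * exp (-(t / 2))) • fderiv ℝ F (exp (-(t / 2)) • x))
    (bound := fun t : ℝ => R * exp (-(t / 2))) (univ_mem' fun _ => trivial) ?_ ?_ ?_ ?_ ?_ ?_
  · exact Eventually.of_forall fun x =>
      ((continuous_exp.comp (continuous_id.div_const _).neg).smul
        (hFc.comp ((continuous_exp.comp (continuous_id.div_const _).neg).smul continuous_const))).aestronglyMeasurable
  · exact transport_integrable hFc hb y
  · exact (((continuous_exp.comp (continuous_id.div_const _).neg).mul
        (continuous_exp.comp (continuous_id.div_const _).neg)).smul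
      (hDc.comp ((continuous_exp.comp (continuous_id.div_const _).neg).smul continuous_const))).aestronglyMeasurable
  · refine (ae_restrict_mem measurableSet_Ioi).mono fun t ht x _ => hbound t ht x
  · have h : IntegrableOn (fun t : ℝ => R * exp (-(1 / 2 : ℝ) * t)) (Ioi 0) :=
      (exp_neg_integrableOn_Ioi 0 (by norm_num : (0:ℝ) < 1 / 2)).const_mul R
    refine h.congr_fun (fun t _ => ?_) measurableSet_Ioi
    show R * exp (-(1 / 2 : ℝ) * t) = R * exp (-(t / 2))
    rw [show (-(1 / 2 : ℝ) * t) = -(t / 2) by ring]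
  · exact Eventually.of_forall fun t x _ => hpt t x

omit [CompleteSpace V] in
/-- **X-type decay of the derivative**: `(1 + ‖y‖) · ‖D(T F)(y)‖ ≤ 2R`. -/
theorem transport_fderiv_norm_le {F : E → V} {R : ℝ} (hF : ContDiff ℝ 1 F)
    (hb : ∀ z, (1 + ‖z‖) ^ 2 * ‖F z‖ ≤ R) (hb' : ∀ z, (1 + ‖z‖) ^ 2 * ‖fderiv ℝ F z‖ ≤ R) (y : E) :
    (1 + ‖y‖) * ‖fderiv ℝ (fun x : E => ∫ t in Ioi (0:ℝ), exp (-(t / 2)) • F (exp (-(t / 2)) • x)) y‖ ≤ 2 * R := by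
  rw [(transport_hasFDerivAt hF hb hb' y).fderiv]
  have hker := transport_kernel_integral (norm_nonneg y)
  have h1 : ‖∫ t in Ioi (0:ℝ), (exp (-(t / 2)) * exp (-(t / 2))) • fderiv ℝ F (exp (-(t / 2)) • y)‖ ≤
      ∫ t in Ioi (0:ℝ), R * (exp (t / 2) / (exp (t / 2) + ‖y‖) ^ 2) := by
    refine norm_integral_le_of_norm_le (hker.1.const_mul R) ?_
    exact (ae_restrict_mem measurableSet_Ioi).mono fun t ht => transport_fderiv_integrand_norm_le hb' y (le_of_lt ht)
  rw [integral_const_mul, hker.2] at h1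
  have hy : 0 < 1 + ‖y‖ := by positivity
  calc (1 + ‖y‖) * ‖∫ t in Ioi (0:ℝ), (exp (-(t / 2)) * exp (-(t / 2))) • fderiv ℝ F (exp (-(t / 2)) • y)‖
      ≤ (1 + ‖y‖) * (R * (2 / (1 + ‖y‖))) := mul_le_mul_of_nonneg_left h1 hy.le
    _ = 2 * R := by field_simp

/-! ## The transport equation `½ T F + ½ D(T F)[y] = F` -/

/-- **`T F` solves the transport equation.**  `½ (T F)(y) + ½ D(T F)(y)[y] = F(y)`: the integrand of the left side is
`−d/dt [e^{-t/2} F(e^{-t/2} y)]`, whose integral over `(0, ∞)` is `F(y) − 0`. -/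
theorem transport_equation {F : E → V} {R : ℝ} (hF : ContDiff ℝ 1 F)
    (hb : ∀ z, (1 + ‖z‖) ^ 2 * ‖F z‖ ≤ R) (hb' : ∀ z, (1 + ‖z‖) ^ 2 * ‖fderiv ℝ F z‖ ≤ R) (y : E) :
    (1/2:ℝ) • (∫ t in Ioi (0:ℝ), exp (-(t / 2)) • F (exp (-(t / 2)) • y)) +
      (1/2:ℝ) • (fderiv ℝ (fun x : E => ∫ t in Ioi (0:ℝ), exp (-(t / 2)) • F (exp (-(t / 2)) • x)) y) y = F y := by
  have hR : 0 ≤ R := le_trans (by positivity) (hb' 0)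
  have hFc : Continuous F := hF.continuous
  have hDc : Continuous (fderiv ℝ F) := hF.continuous_fderiv one_ne_zero
  have hdiff : ∀ z, HasFDerivAt F (fderiv ℝ F z) z := fun z => (hF.differentiable (by norm_num) z).hasFDerivAt
  rw [(transport_hasFDerivAt hF hb hb' y).fderiv]
  -- integrability of the two pieces
  have hI1 : IntegrableOn (fun t : ℝ => exp (-(t / 2)) • F (exp (-(t / 2)) • y)) (Ioi 0) := transport_integrable hFc hb y
  have hker := transport_kernel_integral (norm_nonneg y)
  have hI2 : IntegrableOn (fun t : ℝ => (exp (-(t / 2)) * exp (-(t / 2))) • fderiv ℝ F (exp (-(t / 2)) • y)) (Ioi 0) := by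
    refine Integrable.mono' ((hker.1).const_mul R) ?_ ?_
    · exact (((continuous_exp.comp (continuous_id.div_const _).neg).mul
          (continuous_exp.comp (continuous_id.div_const _).neg)).smul
        (hDc.comp ((continuous_exp.comp (continuous_id.div_const _).neg).smul continuous_const))).aestronglyMeasurable
    · exact (ae_restrict_mem measurableSet_Ioi).mono fun t ht => transport_fderiv_integrand_norm_le hb' y (le_of_lt ht)
  have hI2y : IntegrableOn (fun t : ℝ => ((exp (-(t / 2)) * exp (-(t / 2))) • fderiv ℝ F (exp (-(t / 2)) • y)) y) (Ioi 0) :=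
    hI2.apply_continuousLinearMap y
  -- evaluate the CLM-valued integral at `y` and merge the two integrals
  rw [ContinuousLinearMap.integral_apply hI2 y]
  have hJ1 : Integrable (fun t : ℝ => (1/2:ℝ) • (exp (-(t / 2)) • F (exp (-(t / 2)) • y))) (volume.restrict (Ioi 0)) :=
    hI1.smul (1/2:ℝ)
  have hJ2 : Integrable (fun t : ℝ => (1/2:ℝ) • (((exp (-(t / 2)) * exp (-(t / 2))) • fderiv ℝ F (exp (-(t / 2)) • y)) y))
      (volume.restrict (Ioi 0)) := hI2y.smul (1/2:ℝ)
  rw [← integral_smul, ← integral_smul, ← integral_add hJ1 hJ2]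
  -- the function `Φ t = e^{-t/2} • F (e^{-t/2} • y)`, its derivative, its limits
  have hΦ : ∀ t : ℝ, HasDerivAt (fun s : ℝ => exp (-(s / 2)) • F (exp (-(s / 2)) • y))
      (exp (-(t / 2)) • fderiv ℝ F (exp (-(t / 2)) • y) ((-(1/2:ℝ) * exp (-(t / 2))) • y) +
        (-(1/2:ℝ) * exp (-(t / 2))) • F (exp (-(t / 2)) • y)) t := by
    intro t
    have h0 : HasDerivAt (fun s : ℝ => -(s / 2)) (-(1 / 2 : ℝ)) t :=
      ((hasDerivAt_id' t).div_const (2:ℝ)).neg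
    have he : HasDerivAt (fun s : ℝ => exp (-(s / 2))) (-(1/2:ℝ) * exp (-(t / 2))) t := by
      refine h0.exp.congr_deriv ?_
      show exp (-(t / 2)) * (-(1 / 2 : ℝ)) = -(1/2:ℝ) * exp (-(t / 2))
      ring
    have hin : HasDerivAt (fun s : ℝ => exp (-(s / 2)) • y) ((-(1/2:ℝ) * exp (-(t / 2))) • y) t := he.smul_const y
    have hcomp : HasDerivAt (fun s : ℝ => F (exp (-(s / 2)) • y))
        (fderiv ℝ F (exp (-(t / 2)) • y) ((-(1/2:ℝ) * exp (-(t / 2))) • y)) t :=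
      (hdiff (exp (-(t / 2)) • y)).comp_hasDerivAt t hin
    exact he.smul hcomp
  have hΦlim : Tendsto (fun s : ℝ => exp (-(s / 2)) • F (exp (-(s / 2)) • y)) atTop (𝓝 0) := by
    rw [tendsto_zero_iff_norm_tendsto_zero]
    have h1 : Tendsto (fun s : ℝ => exp (-(s / 2))) atTop (𝓝 0) := by
      refine tendsto_exp_atBot.comp ?_
      exact tendsto_neg_atTop_atBot.comp (tendsto_id.atTop_div_const (by norm_num : (0:ℝ) < 2))
    have hexp : Tendsto (fun s : ℝ => R * exp (-(s / 2))) atTop (𝓝 0) := by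
      simpa using h1.const_mul R
    refine squeeze_zero (fun s => norm_nonneg _) (fun s => ?_) hexp
    rw [norm_smul, Real.norm_eq_abs, abs_of_pos (exp_pos _), mul_comm]
    refine mul_le_mul_of_nonneg_right ?_ (exp_pos _).le
    have h := norm_le_of_weight_sq_le hb (exp (-(s / 2)) • y)
    exact h.trans (div_le_self hR (by nlinarith [norm_nonneg (exp (-(s / 2)) • y)]))
  -- pointwise: our integrand is `-Φ'`
  have hpt : ∀ t : ℝ, (1/2:ℝ) • (exp (-(t / 2)) • F (exp (-(t / 2)) • y)) +
      (1/2:ℝ) • (((exp (-(t / 2)) * exp (-(t / 2))) • fderiv ℝ F (exp (-(t / 2)) • y)) y) =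
      -(exp (-(t / 2)) • fderiv ℝ F (exp (-(t / 2)) • y) ((-(1/2:ℝ) * exp (-(t / 2))) • y) +
        (-(1/2:ℝ) * exp (-(t / 2))) • F (exp (-(t / 2)) • y)) := by
    intro t
    have e1 : (((exp (-(t / 2)) * exp (-(t / 2))) • fderiv ℝ F (exp (-(t / 2)) • y)) y) =
        (exp (-(t / 2)) * exp (-(t / 2))) • fderiv ℝ F (exp (-(t / 2)) • y) y := rfl
    rw [e1, map_smul, smul_smul, smul_smul, neg_add, ← neg_smul, ← neg_smul]
    module
  -- the derivative is integrable (it is a combination of the two integrable pieces)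
  have hderivInt : IntegrableOn (fun t : ℝ => exp (-(t / 2)) • fderiv ℝ F (exp (-(t / 2)) • y) ((-(1/2:ℝ) * exp (-(t / 2))) • y) +
      (-(1/2:ℝ) * exp (-(t / 2))) • F (exp (-(t / 2)) • y)) (Ioi 0) := by
    have h : IntegrableOn (fun t : ℝ => -((1/2:ℝ) • (exp (-(t / 2)) • F (exp (-(t / 2)) • y)) +
        (1/2:ℝ) • (((exp (-(t / 2)) * exp (-(t / 2))) • fderiv ℝ F (exp (-(t / 2)) • y)) y))) (Ioi 0) :=
      (hJ1.add hJ2).neg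
    refine h.congr_fun (fun t _ => ?_) measurableSet_Ioi
    show -((1/2:ℝ) • (exp (-(t / 2)) • F (exp (-(t / 2)) • y)) +
        (1/2:ℝ) • (((exp (-(t / 2)) * exp (-(t / 2))) • fderiv ℝ F (exp (-(t / 2)) • y)) y)) = _
    rw [hpt t, neg_neg]
  have hcont0 : ContinuousWithinAt (fun s : ℝ => exp (-(s / 2)) • F (exp (-(s / 2)) • y)) (Ici 0) 0 :=
    ((continuous_exp.comp (continuous_id.div_const _).neg).smul
      (hFc.comp ((continuous_exp.comp (continuous_id.div_const _).neg).smul continuous_const))).continuousWithinAt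
  have hFTC := integral_Ioi_of_hasDerivAt_of_tendsto hcont0 (fun t _ => hΦ t) hderivInt hΦlim
  have hΦ0 : exp (-((0:ℝ) / 2)) • F (exp (-((0:ℝ) / 2)) • y) = F y := by simp
  rw [hΦ0, zero_sub] at hFTC
  -- conclude
  have hfun : (fun t : ℝ => (1/2:ℝ) • (exp (-(t / 2)) • F (exp (-(t / 2)) • y)) +
      (1/2:ℝ) • (((exp (-(t / 2)) * exp (-(t / 2))) • fderiv ℝ F (exp (-(t / 2)) • y)) y)) =
      fun t => -(exp (-(t / 2)) • fderiv ℝ F (exp (-(t / 2)) • y) ((-(1/2:ℝ) * exp (-(t / 2))) • y) +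
        (-(1/2:ℝ) * exp (-(t / 2))) • F (exp (-(t / 2)) • y)) := funext hpt
  rw [hfun, integral_neg, hFTC, neg_neg]

/-- **The transport resolvent, packaged.**  For `F ∈ C¹` with `(1+‖z‖)² ‖F z‖ ≤ R` and `(1+‖z‖)² ‖DF z‖ ≤ R` there is a
differentiable `W` — explicitly `W y = ∫₀^∞ e^{-t/2} F(e^{-t/2} y) dt` — with `(1+‖y‖) ‖W y‖ ≤ 2R`,
`(1+‖y‖) ‖DW y‖ ≤ 2R`, solving `½ W + ½ DW[y] = F` pointwise.  (The radial part `½ + ½ y·∇` of the line's linearised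
profile operator; one power of `⟨y⟩` is lost, none of `R`.) -/
theorem transport_resolvent {F : E → V} {R : ℝ} (hF : ContDiff ℝ 1 F)
    (hb : ∀ z, (1 + ‖z‖) ^ 2 * ‖F z‖ ≤ R) (hb' : ∀ z, (1 + ‖z‖) ^ 2 * ‖fderiv ℝ F z‖ ≤ R) :
    ∃ W : E → V, (∀ y, W y = ∫ t in Ioi (0:ℝ), exp (-(t / 2)) • F (exp (-(t / 2)) • y)) ∧
      Differentiable ℝ W ∧ (∀ y, (1 + ‖y‖) * ‖W y‖ ≤ 2 * R) ∧ (∀ y, (1 + ‖y‖) * ‖fderiv ℝ W y‖ ≤ 2 * R) ∧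
      ∀ y, (1/2:ℝ) • W y + (1/2:ℝ) • fderiv ℝ W y y = F y :=
  ⟨fun y => ∫ t in Ioi (0:ℝ), exp (-(t / 2)) • F (exp (-(t / 2)) • y), fun _ => rfl,
    fun y => (transport_hasFDerivAt hF hb hb' y).differentiableAt,
    fun y => transport_norm_le hb y, fun y => transport_fderiv_norm_le hF hb hb' y,
    fun y => transport_equation hF hb hb' y⟩

end Transport

end Summit.NavierStokesRegularity.NavierStokesRegularity.Theorems.KelvinGate
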